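import Summits.BirchSwinnertonDyer.BirchSwinnertonDyer.Theorems.PrintCf2DisegniPairTwoFrameFields
import Literature.NumberTheory.EllipticCurves.GlobalMinimalModelHeegnerBaseChangeProofs
import Literature.NumberTheory.EllipticCurves.X049TwistMinimalModelProofs
import Literature.NumberTheory.EllipticCurves.LFunctionPrimeCoeff
import Literature.NumberTheory.NumberFields.SqrtGeneratorUnramified
import Mathlib.RingTheory.RamificationInertia.Ramification
import HarnessLib

/-!
# Road (C) `disegni-pair-two` on crux stmt-BirchSwinnertonDyer-20368 — FRAME, the partner stays globally minimal over `K(√d*)`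

LEAD `bsd-line-cf2-p1` g21, for `stub_frame_two` of `Lines/disegni_pair_two.lean` in its v3.2 shape (the hypothesis `hmin` of
`frame_chi8_two_fixing` & co., i.e. the binder `[(V.baseChange H).IsGloballyMinimal]` of the ticket twin stmt-27325): the good partner `V = W_k = [1, −(3k+1), 0, −2d′², −d′³]` (`d′ = 4k+1` squarefree) stays GLOBALLY MINIMAL over the
tower `H = K(√a)` (`a ∈ {2, −1, −2}`) of an imaginary quadratic `K` with `2` split at whose ramified primes `V` is good. Proof:
the tree's criterion `isGloballyMinimal_baseChange_rat` — every place `w` of `H` lies over a good prime of `V` or is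
unramified over `ℚ`; the bad places lie over ODD primes `q ∤ d_K` (`V` is good at `2` and at the primes of `d_K`), and there
`e(w|q) = e(w_K|q)·e(w|w_K) = 1·1` by the different criterion for square-root extensions
(`Literature.NumberTheory.NumberFields.isUnramifiedAt_of_sq_eq`: `2x ∈ 𝔇` for `x = √d_K`, resp. `x = √a`, and `4d_K`,
resp. `4a`, is prime to `q`; Mathlib `Ideal.ramificationIdx_eq_one`, `Ideal.ramificationIdx_tower`). THEOREMS ONLY; no `sorry`. BSD is not proved by any of this.
-/

set_option linter.dupNamespace false

noncomputable section

open scoped Classical NumberField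

open Polynomial NumberField IsDedekindDomain WeierstrassCurve Literature.NumberTheory.EllipticCurves
  Literature.NumberTheory.QuadraticFields

namespace Summit.BirchSwinnertonDyer.BirchSwinnertonDyer.Theorems.PrintCf2.DisegniPairTwo

/-! ### §1 Integers prime to the residue characteristic are units at `w` -/

/-- For a finite place `w` of a number field `L` over the rational prime `q` and an integer `n` with `q ∤ n`:
`|n|_w = 1`. [folklore] -/
theorem valuation_intCast_eq_one_of_not_dvd {L : Type} [Field L] [NumberField L] (w : HeightOneSpectrum (𝓞 L))
    (n : ℤ) (hn : ¬ ((Rat.HeightOneSpectrum.primesEquiv (w.under (𝓞 ℚ)) : ℕ) : ℤ) ∣ n) :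
    w.valuation L (n : L) = 1 := by
  set v : HeightOneSpectrum (𝓞 ℚ) := w.under (𝓞 ℚ) with hv
  have hle : w.valuation L (((n : 𝓞 L) : L)) ≤ 1 := w.valuation_le_one (n : 𝓞 L)
  have hcast : (((n : 𝓞 L) : L)) = (n : L) := rfl
  rw [hcast] at hle
  refine le_antisymm hle (not_lt.mp fun hlt => hn ?_)
  have hmem : (n : 𝓞 L) ∈ w.asIdeal := by
    rw [← hcast] at hlt
    exact (w.valuation_lt_one_iff_mem (K := L) (n : 𝓞 L)).mp hlt
  have hmemQ : (n : 𝓞 ℚ) ∈ v.asIdeal := by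
    rw [hv, HeightOneSpectrum.under_asIdeal, Ideal.under_def, Ideal.mem_comap, map_intCast]
    exact hmem
  have h := (Ideal.apply_mem_of_equiv_iff (f := Rat.IsIntegralClosure.intEquiv (𝓞 ℚ))).mpr hmemQ
  rw [← Rat.HeightOneSpectrum.span_natGenerator, map_intCast, Ideal.mem_span_singleton] at h
  exact h

/-- If `|x|_w ≤ 1` and `|x|_w² = 1` then `|x|_w = 1`. [folklore] -/
theorem valuation_eq_one_of_sq {L : Type} [Field L] [NumberField L] (w : HeightOneSpectrum (𝓞 L)) {x : L}
    (hle : w.valuation L x ≤ 1) (hsq : w.valuation L (x * x) = 1) : w.valuation L x = 1 := by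
  rcases hle.lt_or_eq with hlt | heq
  · exfalso
    rw [map_mul] at hsq
    have : w.valuation L x * w.valuation L x < 1 := by
      calc w.valuation L x * w.valuation L x ≤ w.valuation L x * 1 := by gcongr
        _ = w.valuation L x := mul_one _
        _ < 1 := hlt
    exact this.ne hsq
  · exact heq

/-! ### §2 The quadratic steps: `e = 1` off `2·(radicand)` -/

/-- In a quadratic extension every element outside the base field generates. [folklore] -/
theorem algebra_adjoin_eq_top_of_finrank_two' {F E : Type*} [Field F] [Field E] [Algebra F E]
    (h2 : Module.finrank F E = 2) {θ : E} (hθ : θ ∉ Set.range (algebraMap F E)) :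
    Algebra.adjoin F {θ} = ⊤ := by
  rw [eq_top_iff]
  intro x _
  obtain ⟨u, v, rfl⟩ := Quadratic.exists_eq_add_mul h2 hθ x
  exact add_mem (Subalgebra.algebraMap_mem _ u)
    (Subalgebra.mul_mem _ (Subalgebra.algebraMap_mem _ v) (Algebra.subset_adjoin rfl))

/-- **A quadratic extension `E(x)/E` with `x² = m ∈ ℤ` is unramified at every place `w` with `|4m|_w = 1`**: `2x` lies in
the different (`isUnramifiedAt_of_sq_eq`), so `e(w | w ∩ E) = 1` (`Ideal.ramificationIdx_eq_one`).
[cite: NeukirchANT1999, Ch. III (2.6)] -/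
theorem ramificationIdx_eq_one_of_sq_eq_int {E L : Type} [Field E] [NumberField E] [Field L] [NumberField L] [Algebra E L]
    (h2 : Module.finrank E L = 2) {x : L} (hxE : x ∉ Set.range (algebraMap E L)) {m : ℤ}
    (hx : x ^ 2 = algebraMap E L (m : E)) (w : HeightOneSpectrum (𝓞 L)) (h4m : w.valuation L (((4 * m : ℤ)) : L) = 1) :
    w.asIdeal.ramificationIdx (𝓞 E) = 1 := by
  -- `x ∈ 𝓞 L`
  have hxZ : x ^ 2 = algebraMap ℤ L m := by rw [hx, map_intCast, eq_intCast]
  have hxi : IsIntegral ℤ x := IsIntegral.of_pow two_pos (by rw [hxZ]; exact isIntegral_algebraMap)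
  set x₀ : 𝓞 L := ⟨x, (mem_integralClosure_iff ℤ L).mpr hxi⟩ with hx₀
  have hx₀L : (x₀ : L) = x := rfl
  have hx₀sq : x₀ ^ 2 = algebraMap (𝓞 E) (𝓞 L) (m : 𝓞 E) := by
    apply RingOfIntegers.coe_injective
    rw [map_pow, ← IsScalarTower.algebraMap_apply (𝓞 E) (𝓞 L) L, map_intCast]
    show x ^ 2 = (m : L)
    rw [hxZ, eq_intCast]
  have hgen : Algebra.adjoin E {(x₀ : L)} = ⊤ := by
    rw [hx₀L]; exact algebra_adjoin_eq_top_of_finrank_two' h2 hxE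
  haveI : w.asIdeal.IsPrime := w.isPrime
  have hQ : algebraMap (𝓞 E) (𝓞 L) (4 * (m : 𝓞 E)) ∉ w.asIdeal := by
    intro hmem
    have hlt := (w.valuation_lt_one_iff_mem (K := L) (algebraMap (𝓞 E) (𝓞 L) (4 * (m : 𝓞 E)))).mpr hmem
    have e : (algebraMap (𝓞 L) L) (algebraMap (𝓞 E) (𝓞 L) (4 * (m : 𝓞 E))) = (((4 * m : ℤ)) : L) := by
      rw [← IsScalarTower.algebraMap_apply (𝓞 E) (𝓞 L) L, map_mul, map_intCast, map_ofNat]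
      push_cast
      ring
    have h1 : w.valuation L ((algebraMap (𝓞 L) L) (algebraMap (𝓞 E) (𝓞 L) (4 * (m : 𝓞 E)))) = 1 := by
      rw [e]; exact h4m
    exact absurd h1 hlt.ne
  haveI := Literature.NumberTheory.NumberFields.isUnramifiedAt_of_sq_eq hx₀sq hgen w.asIdeal hQ
  exact Ideal.ramificationIdx_eq_one w.asIdeal (𝓞 E)

/-! ### §3 The partner stays globally minimal over the tower -/

/-- ★ **`W_k ⊗ H` is globally minimal for the frame's tower `H = K(√a)`** (`a ∈ {2, −1, −2}`, `K` imaginary quadratic with `2` split,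
`W_k` good at the primes of `d_K`) — the text of the hypothesis `hmin` of `frame_chi8_two_fixing` / `frame_chi4_two_fixing` /
`frame_chi8'_two_fixing`, VERBATIM. [cite: SilvermanAEC2009, Prop. VII.5.4 (a) and VIII.8]
[cite: NeukirchANT1999, Ch. III (2.6)] [cite: MazurSteinTate2006, §2.8] -/
theorem partner_baseChange_isGloballyMinimal :
    ∀ (k : ℤ) (V : WeierstrassCurve ℚ) [V.IsElliptic] [V.IsGloballyMinimal],
      V = ⟨1, -(3 * (k : ℚ) + 1), 0, -2 * (4 * (k : ℚ) + 1) ^ 2, -(4 * (k : ℚ) + 1) ^ 3⟩ → Squarefree (4 * k + 1) →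
      ∀ (K : Type) [Field K] [NumberField K], IsImaginaryQuadratic K →
        ((Ideal.span {(2 : ℤ)}).primesOver (𝓞 K)).ncard = 2 →
        (∀ v : HeightOneSpectrum (𝓞 ℚ), ((Rat.HeightOneSpectrum.primesEquiv v : ℕ) : ℤ) ∣ NumberField.discr K →
          V.HasGoodReductionAt v) →
      ∀ (H : Type) [Field H] [NumberField H] [Algebra K H], Module.finrank K H = 2 →
      ∀ (a : ℚ), (a = 2 ∨ a = -1 ∨ a = -2) → ∀ (t : H), t ∉ Set.range (algebraMap K H) → t ^ 2 = algebraMap ℚ H a →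
        (V.baseChange H).IsGloballyMinimal := by
  intro k V _ _ hV _hsq K _ _ hK _hsplit hgood H _ _ _ hKH a ha t htK ht2
  haveI : Fact (2 : ℕ).Prime := ⟨Nat.prime_two⟩
  have h2K : Module.finrank ℚ K = 2 := hK.1
  refine WeierstrassCurve.isGloballyMinimal_baseChange_rat V H (fun w => ?_)
  by_cases hgw : V.HasGoodReductionAt (w.under (𝓞 ℚ))
  · exact Or.inr hgw
  left
  set v : HeightOneSpectrum (𝓞 ℚ) := w.under (𝓞 ℚ) with hv
  set q : ℕ := (Rat.HeightOneSpectrum.primesEquiv v : ℕ) with hq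
  have hqp : q.Prime := (Rat.HeightOneSpectrum.primesEquiv v).2
  -- the bad place lies over an odd prime not dividing `d_K`
  have hq2 : q ≠ 2 := fun h =>
    hgw ((hasGoodReductionAtPrime_primesEquiv_iff_holds V v 2 h).mp (cm7Twist_hasGoodReductionAtPrime_two V k hV))
  have hqD : ¬ (q : ℤ) ∣ NumberField.discr K := fun h => hgw (hgood v h)
  have hq4 : ∀ m : ℤ, (m = 2 ∨ m = -1 ∨ m = -2 ∨ m = NumberField.discr K) → ¬ (q : ℤ) ∣ 4 * m := by
    intro m hm hdvd
    have hqZ : Prime (q : ℤ) := Nat.prime_iff_prime_int.mp hqp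
    have h4 : ¬ (q : ℤ) ∣ 4 := fun h => by
      have := (Nat.prime_dvd_prime_iff_eq hqp Nat.prime_two).mp
        (by exact_mod_cast (hqZ.dvd_of_dvd_pow (show (q : ℤ) ∣ 2 ^ 2 by norm_num; exact h)))
      exact hq2 this
    rcases hqZ.dvd_or_dvd hdvd with h | h
    · exact h4 h
    · rcases hm with rfl | rfl | rfl | rfl
      · have := Int.le_of_dvd (by norm_num) h
        have h2 := hqp.two_le
        have : (q : ℤ) ∣ 2 := h
        have := (Nat.prime_dvd_prime_iff_eq hqp Nat.prime_two).mp (by exact_mod_cast this)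
        exact hq2 this
      · have := Int.eq_one_of_dvd_one (by positivity) (dvd_neg.mp h)
        have h2 := hqp.two_le
        omega
      · have : (q : ℤ) ∣ 2 := (dvd_neg.mp h)
        have := (Nat.prime_dvd_prime_iff_eq hqp Nat.prime_two).mp (by exact_mod_cast this)
        exact hq2 this
      · exact hqD h
  -- the intermediate place `w_K`
  set wK : HeightOneSpectrum (𝓞 K) := w.under (𝓞 K) with hwK
  have hwKv : wK.under (𝓞 ℚ) = v := by
    ext1
    rw [HeightOneSpectrum.under_asIdeal, HeightOneSpectrum.under_asIdeal, hv, HeightOneSpectrum.under_asIdeal,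
      Ideal.under_under]
  -- step 1: `e(w_K | q) = 1` via `x = √d_K`
  obtain ⟨u, hu, hue⟩ := exists_sqrt_discr hK
  have hue' : u ^ 2 = algebraMap ℚ K ((NumberField.discr K : ℤ) : ℚ) := hue
  have e₁ : wK.asIdeal.ramificationIdx (𝓞 ℚ) = 1 := by
    refine ramificationIdx_eq_one_of_sq_eq_int (E := ℚ) h2K hu (m := NumberField.discr K) hue' wK ?_
    have := valuation_intCast_eq_one_of_not_dvd wK (4 * NumberField.discr K)
      (by rw [hwKv]; exact hq4 _ (Or.inr (Or.inr (Or.inr rfl))))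
    exact_mod_cast this
  -- step 2: `e(w | w_K) = 1` via `x = √a`, `a ∈ {2, −1, −2}`
  obtain ⟨m, hm, hma⟩ : ∃ m : ℤ, (m = 2 ∨ m = -1 ∨ m = -2 ∨ m = NumberField.discr K) ∧ (a : ℚ) = (m : ℚ) := by
    rcases ha with rfl | rfl | rfl
    · exact ⟨2, Or.inl rfl, by norm_num⟩
    · exact ⟨-1, Or.inr (Or.inl rfl), by norm_num⟩
    · exact ⟨-2, Or.inr (Or.inr (Or.inl rfl)), by norm_num⟩
  have htd : t ^ 2 = algebraMap K H (m : K) := by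
    rw [ht2, hma, map_intCast, map_intCast]
  have e₂ : w.asIdeal.ramificationIdx (𝓞 K) = 1 := by
    refine ramificationIdx_eq_one_of_sq_eq_int (E := K) hKH htK htd w ?_
    have := valuation_intCast_eq_one_of_not_dvd w (4 * m) (hq4 m hm)
    exact_mod_cast this
  -- tower
  haveI : w.asIdeal.LiesOver (w.asIdeal.under (𝓞 K)) := ⟨rfl⟩
  have htower := Ideal.ramificationIdx_tower (R := 𝓞 ℚ) (w.asIdeal.under (𝓞 K)) w.asIdeal
  have e₁' : (w.asIdeal.under (𝓞 K)).ramificationIdx (𝓞 ℚ) = 1 := by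
    rw [← HeightOneSpectrum.under_asIdeal]; exact e₁
  rw [htower, e₁', e₂]

end Summit.BirchSwinnertonDyer.BirchSwinnertonDyer.Theorems.PrintCf2.DisegniPairTwo

end
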